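import Summits.QuantumFields.YangMills.Theorems.UnitScaleTiltHalvingP1FlatPillarPrimeRows
import HarnessLib

/-!
# `hP1room` PROGRAMME (LEAD-H «H = hP1room» BOARD v1), ENTRY IN THE MULTIPLIER CURRENCY: `core'_of_mlogChart_mult` AND THE ROOMED `P1FlatPillar′` TEXT FROM
# PER-SITE `log`-CHART DATA WHOSE LANDAU CLAUSE IS THE MULTIPLIER FORM (iv)

Route `UnitScaleTilt`, crux K1 child «MinimiserStabilityRegPr» (stmt-QuantumFields-19200), registered stub `stub_halvingStep` (`BirthV10`), text `hP1room`.
A1-LOCATE (★w3-20520 g5, evidence on 19200) FINDING 1: the board's entry ✓`HalvingP1FlatPillarPrimeRows.p1FlatPillar'_room_of_mlogChartData` takes the Landau clause per site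
in the SLICE currency `∀ φ, R ∂*(φ ∘ A) = 0`, whereas the programme's supplier ✓`HalvingP1FlatCoreTransportAssembly.multiplierForm_of_flatLandau_window` delivers the MULTIPLIER
form `Δ∂*A(s) = Σ_i (Q′e_s)(i)•μ(i)` — conjunct (iv) of `core′` itself.  This file is the 2-theorem bridge so that the (A-1) assembler targets the multiplier currency directly:

* §1 ★ `core'_of_mlogChart_mult` — ✓`HalvingP1FlatCoreExtraction.core'_of_mlogChart` with its hypothesis `hslice` REPLACED by `hmult` (the multiplier form, verbatim
  conjunct (iv) of `core′`); same proof minus `multiplier_of_slice`.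
* §2 ★★ `p1FlatPillar'_room_of_mlogChartDataMult` — ✓`p1FlatPillar'_room_of_mlogChartData` with the sixth per-site conjunct `hslice ↦ hmult`; := ✓`p1FlatPillar'_room_of_core'` ∘ §1.

HONEST SCOPE: packaging only (no estimate, no new analysis); `--supports stmt-QuantumFields-19200 --as helper`.  Rung R3 of the ladder (YM₃ on T³ after Bałaban), NOT the
Clay problem; no stub or crux is claimed.

References: T. Bałaban, CMP **99** (1985) 75–102 [Balaban1985RegularSpaces] (Thm 2 p.83, (1.36)–(1.38) p.82); CMP **102** (1985) 277–309 [Balaban1985Variational]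
((150)–(156) pp.301–302).
-/

set_option autoImplicit false

noncomputable section

open scoped BigOperators Matrix.Norms.L2Operator

namespace Summit.QuantumFields.YangMills.Theorems.HalvingP1FlatCoreExtractionMult

open Literature.MathematicalPhysics.QuantumFieldTheory.Balaban1983to89
open Literature.MathematicalPhysics.QuantumFieldTheory.Balaban1983to89.T3ContinuumYM3Torus
open Literature.MathematicalPhysics.QuantumFieldTheory.Balaban1983to89.T3PrintedRegularMinimiser
open Complex (I)
open MatrixLog (mlog)
open B6SectADomainsV1 (Domains)
open B6SectAOperatorsV1 (SiteIdx)
open B7Prop1Explicit (expUnit)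
open B7Prop4Flat (expUnit_mlog)
open B10Eq27TorusAxialLog (transl unitsField toUField suIncl)
open LatticeFieldCalculus (laplace diverg siteAvgIter)
open FlatCubeOpsText (IsLevWeight)
open FlatCubeSequenceAligned (cubeSeqMT3 cubeSetM)
open HalvingP1FlatPillar (DP1Clause)
open HalvingP1FlatPillarPrime (P1FlatPillarAt')
open HalvingP1FlatCoreExtraction (chartUnit_mem isSelfAdjoint_and_trace_zero_of_chart)
open HalvingP1FlatPillarPrimeRows (p1FlatPillar'_room_of_core')

variable {F : T3Family} {n K : ℕ}

/-! ## §1 `core′` from a chart-defined one-form, Landau clause in the MULTIPLIER currency -/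

/-- ★ **`core′` FROM A CHART-DEFINED ONE-FORM, MULTIPLIER CURRENCY** — ✓`HalvingP1FlatCoreExtraction.core'_of_mlogChart` with the exact-slice hypothesis `hslice` replaced by
the multiplier form `hmult : ∃ μ, Δ∂*A(s) = Σ_i (Q′e_s)(i)•μ(i)` (conjunct (iv) of `core′` VERBATIM — the currency of
✓`HalvingP1FlatCoreTransportAssembly.multiplierForm_of_flatLandau_window`): an `SU(2)`-valued gauge `u` with the D-P1 clause (o), the near-identity
`‖u(z)⁻¹U(b)u(z+e_μ) − 1‖ ≤ 1∕4` and the chart `i·η·A(b) = log(u(z)⁻¹U(b)u(z+e_μ))` on the bonds with both ends in `Ω₀`, `A = 0` off them, the (1.36)♭ sizes (iii), and (iv),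
give `core′` ((ii′) by `e^{log W} = W`, (i) by ✓`isSelfAdjoint_and_trace_zero_of_chart`). [cite: Balaban1985RegularSpaces, Thm 2 p.83, (1.36)-(1.38) p.82; Balaban1985Variational, (150)-(156) pp.301-302] -/
theorem core'_of_mlogChart_mult (D : Domains (F.P K)) (Ω₀ : Set (Site (F.P K) 0)) (x : Site (F.P K) 0) {ε₀ B₁ : ℝ}
    {U : GaugeField (F.P K) 0 (Matrix.specialUnitaryGroup (Fin 2) ℂ)}
    (u : GaugeTransf (F.P K) 0 (Matrix.specialUnitaryGroup (Fin 2) ℂ)) (A : PBond (F.P K) 0 → Matrix (Fin 2) (Fin 2) ℂ)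
    (ho : DP1Clause F n K D x U (fun s => suIncl (u s)))
    (hnear : ∀ (z : B7Prop1Explicit.Site (F.P K).d) (μ : Fin (F.P K).d), transl (0 : Site (F.P K) 0) z ∈ Ω₀ →
      (transl (0 : Site (F.P K) 0) z).shift μ ∈ Ω₀ →
      ‖(((Unitary.toUnits (suIncl (u (transl 0 z))))⁻¹ * unitsField (toUField U) ⟨transl 0 z, μ⟩ *
          Unitary.toUnits (suIncl (u ((transl 0 z).shift μ))) : (Matrix (Fin 2) (Fin 2) ℂ)ˣ) : Matrix (Fin 2) (Fin 2) ℂ) - 1‖ ≤ 1 / 4)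
    (hA : ∀ (z : B7Prop1Explicit.Site (F.P K).d) (μ : Fin (F.P K).d), transl (0 : Site (F.P K) 0) z ∈ Ω₀ →
      (transl (0 : Site (F.P K) 0) z).shift μ ∈ Ω₀ →
      I • ((((F.L : ℝ)⁻¹) ^ (K - n)) • A ⟨transl 0 z, μ⟩) =
        mlog (((Unitary.toUnits (suIncl (u (transl 0 z))))⁻¹ * unitsField (toUField U) ⟨transl 0 z, μ⟩ *
          Unitary.toUnits (suIncl (u ((transl 0 z).shift μ))) : (Matrix (Fin 2) (Fin 2) ℂ)ˣ) : Matrix (Fin 2) (Fin 2) ℂ))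
    (hA0 : ∀ b : PBond (F.P K) 0, ¬ (∃ z : B7Prop1Explicit.Site (F.P K).d, transl (0 : Site (F.P K) 0) z ∈ Ω₀ ∧
      (transl (0 : Site (F.P K) 0) z).shift b.dir ∈ Ω₀ ∧ b = ⟨transl 0 z, b.dir⟩) → A b = 0)
    (hsize : ∀ w : ℕ → PBond (F.P K) 0 → ℝ, IsLevWeight F n K D w →
      (∀ b : PBond (F.P K) 0, w 1 b * ‖A b‖ ≤ B₁ * ε₀) ∧
      (∀ (b : PBond (F.P K) 0) (ν : Fin (F.P K).d), w 2 b * (F.L : ℝ) ^ (K - n) * ‖A ⟨b.src.shift ν, b.dir⟩ - A b‖ ≤ B₁ * ε₀))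
    (hmult : ∃ μ : SiteIdx D → Matrix (Fin 2) (Fin 2) ℂ, ∀ s : Site (F.P K) 0,
      laplace ((F.L : ℝ) ^ (K - n)) (diverg ((F.L : ℝ) ^ (K - n)) A) s =
        ∑ i : SiteIdx D, siteAvgIter (i.1.1 : ℕ) (Pi.single s (1 : ℝ)) i.1.2 • μ i) :
    ∃ (u : GaugeTransf (F.P K) 0 (Matrix.unitaryGroup (Fin 2) ℂ)) (A : PBond (F.P K) 0 → Matrix (Fin 2) (Fin 2) ℂ),
      DP1Clause F n K D x U u ∧
      (∀ b : PBond (F.P K) 0, IsSelfAdjoint (A b)) ∧ (∀ b : PBond (F.P K) 0, Matrix.trace (A b) = 0) ∧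
      (∀ (z : B7Prop1Explicit.Site (F.P K).d) (μ : Fin (F.P K).d), transl (0 : Site (F.P K) 0) z ∈ Ω₀ →
        (transl (0 : Site (F.P K) 0) z).shift μ ∈ Ω₀ →
        (Unitary.toUnits (u (transl 0 z)))⁻¹ * unitsField (toUField U) ⟨transl 0 z, μ⟩ * Unitary.toUnits (u ((transl 0 z).shift μ)) =
          expUnit (I • ((((F.L : ℝ)⁻¹) ^ (K - n)) • A ⟨transl 0 z, μ⟩))) ∧
      (∀ w : ℕ → PBond (F.P K) 0 → ℝ, IsLevWeight F n K D w →
        (∀ b : PBond (F.P K) 0, w 1 b * ‖A b‖ ≤ B₁ * ε₀) ∧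
        (∀ (b : PBond (F.P K) 0) (ν : Fin (F.P K).d), w 2 b * (F.L : ℝ) ^ (K - n) * ‖A ⟨b.src.shift ν, b.dir⟩ - A b‖ ≤ B₁ * ε₀)) ∧
      (∃ μ : SiteIdx D → Matrix (Fin 2) (Fin 2) ℂ, ∀ s : Site (F.P K) 0,
        laplace ((F.L : ℝ) ^ (K - n)) (diverg ((F.L : ℝ) ^ (K - n)) A) s =
          ∑ i : SiteIdx D, siteAvgIter (i.1.1 : ℕ) (Pi.single s (1 : ℝ)) i.1.2 • μ i) := by
  have hη : ((F.L : ℝ)⁻¹) ^ (K - n) ≠ 0 :=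
    pow_ne_zero _ (inv_ne_zero (Nat.cast_ne_zero.2 (F.P K).L_pos.ne'))
  -- (i) on every bond
  have hsatr : ∀ b : PBond (F.P K) 0, IsSelfAdjoint (A b) ∧ Matrix.trace (A b) = 0 := by
    intro b
    by_cases hb : ∃ z : B7Prop1Explicit.Site (F.P K).d, transl (0 : Site (F.P K) 0) z ∈ Ω₀ ∧
        (transl (0 : Site (F.P K) 0) z).shift b.dir ∈ Ω₀ ∧ b = ⟨transl 0 z, b.dir⟩
    · obtain ⟨z, hz, hz', hbz⟩ := hb
      obtain ⟨hWu, hWdet⟩ := chartUnit_mem u U (transl 0 z) ((transl (0 : Site (F.P K) 0) z).shift b.dir) ⟨transl 0 z, b.dir⟩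
      have h := isSelfAdjoint_and_trace_zero_of_chart hWu hWdet (hnear z b.dir hz hz') hη (hA z b.dir hz hz')
      rw [hbz]
      exact h
    · rw [hA0 b hb]
      exact ⟨IsSelfAdjoint.zero _, Matrix.trace_zero _ _⟩
  refine ⟨fun s => suIncl (u s), A, ho, fun b => (hsatr b).1, fun b => (hsatr b).2, fun z μ hz hz' => ?_, hsize, hmult⟩
  -- (ii′): `e^{log W} = W`
  rw [hA z μ hz hz']
  exact (expUnit_mlog (lt_of_le_of_lt (hnear z μ hz hz') (by norm_num))).symm

/-! ## §2 The roomed `P1FlatPillar′` text from per-site `log`-chart data in the multiplier currency -/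

/-- ★★ **THE ROOMED `P1FlatPillar′` TEXT (`hP1room`'s body at fixed constants) FROM PER-SITE `log`-CHART DATA WITH THE LANDAU CLAUSE IN THE MULTIPLIER CURRENCY** —
✓`HalvingP1FlatPillarPrimeRows.p1FlatPillar'_room_of_mlogChartData` with the sixth per-site conjunct `hslice ↦ hmult` (the (A-1) assembler's target of LEAD-H's «H = hP1room»
board: (o) from (R3) `dp1Clause_of_top_junction`, near∕chart∕off-window from (R1) `junction_chart`, (iii) from the sizes, (iv) from (R2) `multiplierForm_of_flatLandau_window`
after `rw [inv_pow, inv_inv]`); := ✓`p1FlatPillar'_room_of_core'` ∘ §1. [cite: Balaban1985RegularSpaces, Thm 2 p.83, (1.36)-(1.38) p.82; Balaban1985Variational, (144) p.300, (150)-(156) pp.301-302] -/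
theorem p1FlatPillar'_room_of_mlogChartDataMult (L ρ S M Nr : ℕ) (hM : 1 ≤ M) {R' : ℕ} (hRS : R' * M ≤ S) (hRM : 2 * L ≤ R' * M + 1) (hS : 1 ≤ S)
    {a Cr B₁ : ℝ} (hCr : 0 < Cr) (hreg₁ : 12 * ((ρ : ℝ) + (M : ℝ)) * a ≤ Cr)
    (hreg₀ : 16 * 3800 * ((5 * L : ℕ) : ℝ) ^ 2 * (L : ℝ) * ((B₁ + 1) * a) ≤ 1) (hB₁ : 0 ≤ B₁ + 1)
    (hJ4 : ∀ F : T3Family, F.L = L → ∀ (n K : ℕ) (hnK : n < K), 2 * ρ + Nr ≤ F.L ^ (F.m + n) → ∀ (ε₀ ε₁ : ℝ), 0 < ε₁ → 0 < ε₀ → ε₀ ≤ a → Cr * ε₁ ≤ ε₀ →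
      ∀ V : GaugeField (F.P n) 0 (Matrix.specialUnitaryGroup (Fin 2) ℂ), PlaqSmall ε₁ V →
        ∀ U ∈ regFibrePr F n K hnK.le ε₀ V, ∀ x : Site (F.P K) 0,
          ∃ (u : GaugeTransf (F.P K) 0 (Matrix.specialUnitaryGroup (Fin 2) ℂ)) (A : PBond (F.P K) 0 → Matrix (Fin 2) (Fin 2) ℂ),
            DP1Clause F n K (cubeSeqMT3 F n K x ρ S M hM) x U (fun s => suIncl (u s)) ∧
            (∀ (z : B7Prop1Explicit.Site (F.P K).d) (μ : Fin (F.P K).d), transl (0 : Site (F.P K) 0) z ∈ cubeSetM x (K - n) ρ S M 0 →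
              (transl (0 : Site (F.P K) 0) z).shift μ ∈ cubeSetM x (K - n) ρ S M 0 →
              ‖(((Unitary.toUnits (suIncl (u (transl 0 z))))⁻¹ * unitsField (toUField U) ⟨transl 0 z, μ⟩ *
                  Unitary.toUnits (suIncl (u ((transl 0 z).shift μ))) : (Matrix (Fin 2) (Fin 2) ℂ)ˣ) : Matrix (Fin 2) (Fin 2) ℂ) - 1‖ ≤ 1 / 4) ∧
            (∀ (z : B7Prop1Explicit.Site (F.P K).d) (μ : Fin (F.P K).d), transl (0 : Site (F.P K) 0) z ∈ cubeSetM x (K - n) ρ S M 0 →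
              (transl (0 : Site (F.P K) 0) z).shift μ ∈ cubeSetM x (K - n) ρ S M 0 →
              I • ((((F.L : ℝ)⁻¹) ^ (K - n)) • A ⟨transl 0 z, μ⟩) =
                mlog (((Unitary.toUnits (suIncl (u (transl 0 z))))⁻¹ * unitsField (toUField U) ⟨transl 0 z, μ⟩ *
                  Unitary.toUnits (suIncl (u ((transl 0 z).shift μ))) : (Matrix (Fin 2) (Fin 2) ℂ)ˣ) : Matrix (Fin 2) (Fin 2) ℂ)) ∧
            (∀ b : PBond (F.P K) 0, ¬ (∃ z : B7Prop1Explicit.Site (F.P K).d, transl (0 : Site (F.P K) 0) z ∈ cubeSetM x (K - n) ρ S M 0 ∧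
              (transl (0 : Site (F.P K) 0) z).shift b.dir ∈ cubeSetM x (K - n) ρ S M 0 ∧ b = ⟨transl 0 z, b.dir⟩) → A b = 0) ∧
            (∀ w : ℕ → PBond (F.P K) 0 → ℝ, IsLevWeight F n K (cubeSeqMT3 F n K x ρ S M hM) w →
              (∀ b : PBond (F.P K) 0, w 1 b * ‖A b‖ ≤ B₁ * ε₀) ∧
              (∀ (b : PBond (F.P K) 0) (ν : Fin (F.P K).d), w 2 b * (F.L : ℝ) ^ (K - n) * ‖A ⟨b.src.shift ν, b.dir⟩ - A b‖ ≤ B₁ * ε₀)) ∧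
            (∃ μ : SiteIdx (cubeSeqMT3 F n K x ρ S M hM) → Matrix (Fin 2) (Fin 2) ℂ, ∀ s : Site (F.P K) 0,
              laplace ((F.L : ℝ) ^ (K - n)) (diverg ((F.L : ℝ) ^ (K - n)) A) s =
                ∑ i : SiteIdx (cubeSeqMT3 F n K x ρ S M hM), siteAvgIter (i.1.1 : ℕ) (Pi.single s (1 : ℝ)) i.1.2 • μ i)) :
    ∀ F : T3Family, F.L = L → ∀ (n K : ℕ) (hnK : n < K), 2 * ρ + Nr ≤ F.L ^ (F.m + n) → ∀ (ε₀ ε₁ : ℝ), 0 < ε₁ → 0 < ε₀ → ε₀ ≤ a → Cr * ε₁ ≤ ε₀ →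
      ∀ V : GaugeField (F.P n) 0 (Matrix.specialUnitaryGroup (Fin 2) ℂ), PlaqSmall ε₁ V →
        ∀ U ∈ regFibrePr F n K hnK.le ε₀ V, ∀ x : Site (F.P K) 0,
          P1FlatPillarAt' F n K (cubeSeqMT3 F n K x ρ S M hM) (cubeSetM x (K - n) ρ S M 0) x ε₀ ε₁ B₁ 6 (8 * (L : ℝ) * (B₁ + 1)) U := by
  refine p1FlatPillar'_room_of_core' L ρ S M Nr hM hRS hRM hS hCr hreg₁ hreg₀ hB₁
    fun F hF n K hnK hroom ε₀ ε₁ hε₁ hε₀ hε₀a hCrε V hV U hU x => ?_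
  obtain ⟨u, A, ho, hnear, hA, hA0, hsize, hmult⟩ := hJ4 F hF n K hnK hroom ε₀ ε₁ hε₁ hε₀ hε₀a hCrε V hV U hU x
  exact core'_of_mlogChart_mult (cubeSeqMT3 F n K x ρ S M hM) (cubeSetM x (K - n) ρ S M 0) x u A ho hnear hA hA0 hsize hmult

end Summit.QuantumFields.YangMills.Theorems.HalvingP1FlatCoreExtractionMult

end
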